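import Mathlib
import Summits.Ventures.PercRepro2.SwOutCrossJunctionMarkRegion
import Summits.Ventures.PercRepro2.SwOutCrossJunctionExample4

/-!
# The series reduction composed with the cross junction, on an instance (blind cell PercRepro2,
night-4 g27, 2026-08-28; proofs/NIGHT4-G27.md §6‴)

`crossEx6` is g24's `crossEx` with the cross edge `p₁p₂ = 45` SUBDIVIDED by the vertex `s = 7`
(edges `47`, `75`; ten edges on `Fin 8`): the region `{l}ᶜ` is NOT a cross junction (`7` is a
u-neighbour's neighbour without an outside edge), but `7` is a SERIES vertex, and both graphs of
the series step are cross-junction regions — the contraction restores the cross edge (the cross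
graph `⊤` on `Fin 2`), the deletion leaves two single dropped vertices (the cross graph `⊥`) —
each with the mark anywhere (`CrossJunctionM.moveMark`).  Hence, by `Reducible.series` and
`CrossJunctionM.reducible`, **`sw_crossEx6_mark : ∀ o, o ≠ 7 → Sw crossEx6 0 1 o`** — the first
instance of the lane on a graph that is not itself a junction region.  The junction structures of
the contracted and deleted graphs are proved by `decide` (`Function.update` evaluates).
-/

namespace Summit.Ventures.PercRepro2

namespace CrossArm

open Hull LocRows

/-- `crossEx` with the cross edge subdivided: `l = 0`, `h = 1`, `o = 2`, `u = 3`, `p₁ = 4`,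
`p₂ = 5`, the u-arm `x = 6`, the series vertex `s = 7`; edges `hx, ux, up₁, up₂, p₁s, sp₂, xl,
p₁l, p₂l, ol`. -/
def crossEx6 : Fin 10 → Sym2 (Fin 8) :=
  ![s(1, 6), s(3, 6), s(3, 4), s(3, 5), s(4, 7), s(7, 5), s(6, 0), s(4, 0), s(5, 0), s(2, 0)]

/-- The two dropped vertices. -/
def crossEx6P : Fin 2 → Fin 8 := ![4, 5]

/-- The region of the series step: `{l}ᶜ` without the series vertex. -/
abbrev crossEx6U : Set (Fin 8) := ({0}ᶜ : Set (Fin 8)) \ {7}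

/-- `7` is a series vertex of `crossEx6` between `p₁ = 4` and `p₂ = 5`. -/
theorem crossEx6_series : IsSeriesAt crossEx6 7 4 5 4 5 where
  ends₁ := by decide
  ends₂ := by decide
  ne := by decide
  up := by decide
  uq := by decide
  only := by decide

/-- The contracted graph (`75 ↦ 45`, `47 ↦` a loop at `7`) is a cross junction on the region
without `7`, with the mark `2`. -/
theorem crossEx6C_junction :
    CrossJunctionM (contractSeries crossEx6 7 4 5 4 5) crossEx6U 1 3 crossEx6P
      (⊤ : SimpleGraph (Fin 2)) 2 where
  hne_hu := by decide
  hne_hp := by decide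
  hne_up := by decide
  p_inj := by intro i j h; revert i j; decide
  hhU := by simp
  huU := by simp
  hpU := by
    intro i
    simp only [crossEx6U, Set.mem_sdiff, Set.mem_compl_iff, Set.mem_singleton_iff]
    revert i
    decide
  hloop_h := by decide
  hloop_u := by decide
  hnadj := by decide
  hnadj_p := by decide
  hup := by decide
  hcross := by decide
  hcross_adj := by decide
  hcross_simple := by decide
  hu_adj_h := by decide
  hp_in := by
    intro i e x he hxU
    simp only [crossEx6U, Set.mem_sdiff, Set.mem_compl_iff, Set.mem_singleton_iff] at hxU
    revert i e x
    decide
  hout := by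
    intro x hx hx1 hx2 hx3
    simp only [crossEx6U, Set.mem_sdiff, Set.mem_compl_iff, Set.mem_singleton_iff] at hx ⊢
    revert x
    decide
  hext_o := by decide

/-- The deleted graph (both edges at `7` loops) is a cross junction on the region without `7`,
with the mark `2` and NO cross edge. -/
theorem crossEx6D_junction :
    CrossJunctionM (deleteSeries crossEx6 7 4 5) crossEx6U 1 3 crossEx6P
      (⊥ : SimpleGraph (Fin 2)) 2 where
  hne_hu := by decide
  hne_hp := by decide
  hne_up := by decide
  p_inj := by intro i j h; revert i j; decide
  hhU := by simp
  huU := by simp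
  hpU := by
    intro i
    simp only [crossEx6U, Set.mem_sdiff, Set.mem_compl_iff, Set.mem_singleton_iff]
    revert i
    decide
  hloop_h := by decide
  hloop_u := by decide
  hnadj := by decide
  hnadj_p := by decide
  hup := by decide
  hcross := by decide
  hcross_adj := by decide
  hcross_simple := by decide
  hu_adj_h := by decide
  hp_in := by
    intro i e x he hxU
    simp only [crossEx6U, Set.mem_sdiff, Set.mem_compl_iff, Set.mem_singleton_iff] at hxU
    revert i e x
    decide
  hout := by
    intro x hx hx1 hx2 hx3
    simp only [crossEx6U, Set.mem_sdiff, Set.mem_compl_iff, Set.mem_singleton_iff] at hx ⊢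
    revert x
    decide
  hext_o := by decide

open scoped Classical in
/-- **Row (SW) on `crossEx6` with the mark at any vertex other than the series vertex** — the
series step at `7`, both branches cross-junction regions with the mark moved. -/
theorem sw_crossEx6_mark (o : Fin 8) (ho : o ≠ 7) : Sw crossEx6 0 1 o := by
  refine sw_of_swAll _ (swAll_of_reducible 0 1 o (by decide) ?_)
  refine Reducible.series crossEx6 ({0}ᶜ) 7 4 5 4 5 crossEx6_series (by simp) (by simp)
    (by decide) (by decide) (Ne.symm ho) ?_ ?_
  · exact ((crossEx6C_junction.moveMark o (Or.inl ⟨9, 0, by decide, by simp⟩)).reducible (by simp))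
  · exact ((crossEx6D_junction.moveMark o (Or.inl ⟨9, 0, by decide, by simp⟩)).reducible (by simp))

end CrossArm

end Summit.Ventures.PercRepro2
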